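import Literature.NumberTheory.QuadraticFields.AmbiguousClasses
import Literature.NumberTheory.QuadraticFields.GenusCharacters
import Literature.NumberTheory.QuadraticFields.RedeiReichardtRamifiedPrimes
import Literature.NumberTheory.QuadraticFields.RedeiReichardtDiscriminant
import Literature.NumberTheory.EllipticCurves.Tian2014.CongruentNumbersHeegnerPoints
import Mathlib.NumberTheory.LegendreSymbol.QuadraticReciprocity
import Mathlib.NumberTheory.LegendreSymbol.JacobiSymbol
import HarnessLib

/-!
# Rédei–Reichardt for `ℚ(√−2pq)`, PROVED: no ideal class of order `4` when `p ≡ 5 (mod 8)`,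
# `q ≡ 3 (mod 4)` and `(p/q) = −1` or `q ≡ 3 (mod 8)`

Topic `NumberTheory/QuadraticFields`, namespace `Literature.NumberTheory.QuadraticFields.RedeiReichardt`.
Theorem-only file (no definition, no named fact): a SPECIAL CASE of the Rédei–Reichardt theorem
(`redeiReichardt_fourTwoCard_classGroup`, Li–Ma 2008 Thm. 0.4, vendored in `RedeiMatrixFourRank.lean` as a
named fact) proved outright in the kernel from the tree's PROVED genus theory:

* Gauss's count of ambiguous classes `#Cl_K[2] = 2^{t−1}` (`Quadratic.card_sq_eq_one_classGroup`,
  `AmbiguousClasses.lean`), here `t = 3` (`d_K = −8pq`), so `#Cl_K[2] = 4`;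
* the ramified primes `𝔭₂ = (2, √−2pq)`, `𝔭_p`, `𝔭_q` with `𝔭_ℓ² = (ℓ)`, `N𝔭_ℓ = ℓ`, `𝔭₂𝔭_p𝔭_q = (√−2pq)`
  (`RedeiReichardtRamifiedPrimes.lean`), giving three classes of order dividing `2` with `[𝔭₂][𝔭_p][𝔭_q] = 1`;
* the genus characters `ψ_p, ψ_q : Cl_K → {±1}`, `ψ_r([𝔞]) = (N𝔞/r)` (`GenusCharacters.lean`), trivial on squares.

For `K = ℚ(√−2pq)`, `p ≡ 5 (mod 8)`, `q ≡ 3 (mod 4)`: `ψ_p([𝔭₂]) = (2/p) = −1`, `ψ_p([𝔭_q]) = (q/p) = (p/q) =: ε`,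
`ψ_q([𝔭₂]) = (2/q) =: s`, `ψ_q([𝔭_p]) = ε`, and by the relation `ψ_q([𝔭_q]) = sε`, `ψ_p([𝔭_p]) = −ε`. If `ε = −1`
or `s = −1` (i.e. `(p/q) = −1` or `q ≡ 3 (mod 8)`) the four pairs `(ψ_p, ψ_q)` on `{1, [𝔭₂], [𝔭_p], [𝔭_q]}` are
DISTINCT and only `1 ↦ (1, 1)`; so these four classes exhaust `Cl_K[2]` and the only square among them is `1`:
`#(Cl_K² ∩ Cl_K[2]) = 1` (`fourTwoCard = 1`), i.e. `Cl_K` has no element of order `4` — Rédei's `3 × 3` matrix on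
`(2, p, q)` has rank `2` (the tree's `P2.odd_genusClassNumber_genusField_two_mul_five_mul_iff` decides the same
parity MODULO the named fact; this file removes the fact for these residue classes).

Main results: `genusCharValue_eq_one_of_isSquare`, `genusCharValue_mk0_of_sq_eq_span` (bookkeeping),
`fourTwoCard_classGroup_eq_one_of_sqrt_neg_two_mul_primes` (the theorem, hypothesis shape
`IsQuadraticFieldOfSqrt K (−2pq)` = that of the named fact).

## References
* [Cox2013] D. A. Cox, *Primes of the form x² + ny²*, 2nd ed. (2013), §3.B Prop. 3.11, Lemma 3.13, Thm. 3.15.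
* [Stevenhagen1995RedeiMatrices] P. Stevenhagen, *Rédei-matrices and applications*, LMS LNS 215 (1995), §2.
* [LiMa2008] Y. Li, L. Ma, Acta Arith. 134 (2008), Lemma 0.1, Thm. 0.4 (Rédei–Reichardt).
* [RedeiReichardt1934] L. Rédei, H. Reichardt, J. reine angew. Math. 170 (1934), 69–74.
-/

noncomputable section

open NumberField Ideal Module
open scoped nonZeroDivisors

namespace Literature.NumberTheory.QuadraticFields.RedeiReichardt

open Literature.NumberTheory.QuadraticFields.Quadratic
open Literature.NumberTheory.EllipticCurves (IsImaginaryQuadratic)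
open Literature.NumberTheory.EllipticCurves.Tian2014 (fourTwoCard IsQuadraticFieldOfSqrt)

variable {K : Type*} [Field K] [NumberField K]

/-! ### Two bookkeeping lemmas on genus characters -/

/-- **A genus character is trivial on squares**: `ψ_r(b²) = ψ_r(b)² = 1` (`ψ_r` takes the values `±1`).
[cite: Cox2013, §3.B Thm. 3.15] -/
theorem genusCharValue_eq_one_of_isSquare (hK : IsImaginaryQuadratic K) {r : ℕ} [Fact r.Prime]
    (hr2 : r ≠ 2) (hrd : (r : ℤ) ∣ NumberField.discr K) {a : ClassGroup (𝓞 K)} (ha : IsSquare a) :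
    genusCharValue r a = 1 := by
  obtain ⟨b, rfl⟩ := ha
  rw [genusCharValue_mul hK hr2 hrd]
  rcases genusCharValue_eq_one_or hK (p := r) b with h | h <;> rw [h] <;> norm_num

/-- **The genus character on a ramified class**: if `P² = (ℓ)` for a prime `ℓ ≠ r` (so `N P = ℓ` is prime to
`r`), then `ψ_r([P]) = (ℓ/r)`. [cite: Cox2013, §3.B Thm. 3.15] [cite: Stevenhagen1995RedeiMatrices, §2] -/
theorem genusCharValue_mk0_of_sq_eq_span (hK : IsImaginaryQuadratic K) {r : ℕ} [Fact r.Prime]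
    (hr2 : r ≠ 2) (hrd : (r : ℤ) ∣ NumberField.discr K) {ℓ : ℕ} (hℓ : ℓ.Prime) (hℓr : ℓ ≠ r)
    {P : Ideal (𝓞 K)} (hP : P ^ 2 = span {(ℓ : 𝓞 K)}) (hP0 : P ∈ (Ideal (𝓞 K))⁰) :
    genusCharValue r (ClassGroup.mk0 ⟨P, hP0⟩) = legendreSym r ℓ := by
  have hN : absNorm P = ℓ := absNorm_eq_of_sq_eq_span hK.1 hP
  have hrℓ : ¬ (r : ℤ) ∣ (absNorm P : ℤ) := by
    rw [hN, Int.natCast_dvd_natCast]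
    intro h
    exact hℓr ((Nat.prime_dvd_prime_iff_eq (Fact.out : r.Prime) hℓ).mp h).symm
  rw [genusCharValue_eq hK hr2 hrd hP0 hrℓ, hN]

/-! ### The theorem -/

/-- **Rédei–Reichardt for `ℚ(√−2pq)` (proved): `#(Cl_K² ∩ Cl_K[2]) = 1`** — no ideal class of order `4` —
for a quadratic field `K ∋ √−2pq` with primes `p ≡ 5 (mod 8)`, `q ≡ 3 (mod 4)` such that `(p/q) = −1` or
`q ≡ 3 (mod 8)`. Proof: `#Cl_K[2] = 2^{3−1} = 4` (Gauss), the classes `1, [𝔭₂], [𝔭_p], [𝔭_q]` lie in `Cl_K[2]`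
and are separated by `(ψ_p, ψ_q)` with values `(1,1), (−1,s), (−ε,ε), (ε,sε)` (`ε = (p/q)`, `s = (2/q)`, not both
`+1`), so they ARE `Cl_K[2]`, and a square in `Cl_K[2]` has `(ψ_p, ψ_q) = (1, 1)`, hence is `1`. (Rédei's matrix on
`(2, p, q)` has rank `2`; cf. Li–Ma Thm. 0.4: `r₄ = t − 1 − rank = 0`.)
[cite: Cox2013, §3.B Prop. 3.11, Thm. 3.15] [cite: Stevenhagen1995RedeiMatrices, §2 Thm. 1 (l = 2)]
[cite: LiMa2008, Thm. 0.4 with Lemma 0.1] -/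
theorem fourTwoCard_classGroup_eq_one_of_sqrt_neg_two_mul_primes {p q : ℕ} (hp : p.Prime) (hq : q.Prime)
    (hp5 : p % 8 = 5) (hq4 : q % 4 = 3) (hpq : jacobiSym p q = -1 ∨ q % 8 = 3)
    (hK : IsQuadraticFieldOfSqrt K (-((2 * (p * q) : ℕ) : ℤ))) :
    fourTwoCard (ClassGroup (𝓞 K)) = 1 := by
  classical
  -- the primes
  have hp2 : p ≠ 2 := by omega
  have hq2 : q ≠ 2 := by omega
  have hne : p ≠ q := by omega
  haveI : Fact p.Prime := ⟨hp⟩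
  haveI : Fact q.Prime := ⟨hq⟩
  set n : ℕ := 2 * (p * q) with hn_def
  have hn : Squarefree n := by
    rw [hn_def, Nat.squarefree_mul_iff, Nat.squarefree_mul_iff]
    exact ⟨Nat.Coprime.mul_right ((Nat.coprime_primes Nat.prime_two hp).mpr hp2.symm)
      ((Nat.coprime_primes Nat.prime_two hq).mpr hq2.symm), Nat.squarefree_two,
      (Nat.coprime_primes hp hq).mpr hne, hp.squarefree, hq.squarefree⟩
  -- the field: `√−n ∈ 𝓞_K`, `d_K = −4n = −8pq`
  obtain ⟨h2, x, hx⟩ := hK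
  have hx' : x ^ 2 = -(n : K) := by rw [hx]; push_cast; ring
  obtain ⟨y, -, hy⟩ := exists_ringOfIntegers_sq_eq_neg hx'
  have hIQ : IsImaginaryQuadratic K := isImaginaryQuadratic h2 hn hx'
  have hdisc : NumberField.discr K = -4 * n := by
    rw [discr_eq h2 hn hx', if_neg (by omega)]
  have hpd : (p : ℤ) ∣ NumberField.discr K :=
    ⟨-(8 * q : ℤ), by rw [hdisc, hn_def]; push_cast; ring⟩
  have hqd : (q : ℤ) ∣ NumberField.discr K :=
    ⟨-(8 * p : ℤ), by rw [hdisc, hn_def]; push_cast; ring⟩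
  -- Gauss: `#Cl_K[2] = 2^{t−1} = 4`
  set T : Finset (ClassGroup (𝓞 K)) := Finset.univ.filter (fun c => c ^ 2 = 1) with hT_def
  have hT : T.card = 4 := by
    have h := card_sq_eq_one_classGroup hIQ
    rw [Nat.card_eq_fintype_card, Fintype.card_subtype, natAbs_discr_eq h2 hn hx',
      if_neg (by omega)] at h
    have hpf : (4 * n).primeFactors = {2, p, q} := by
      rw [hn_def, show 4 * (2 * (p * q)) = 2 ^ 3 * (p * q) by ring,
        Nat.primeFactors_mul (by positivity) (Nat.mul_ne_zero hp.ne_zero hq.ne_zero),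
        Nat.primeFactors_prime_pow (by norm_num) Nat.prime_two,
        Nat.primeFactors_mul hp.ne_zero hq.ne_zero, hp.primeFactors, hq.primeFactors]
      ext r
      simp only [Finset.mem_union, Finset.mem_insert, Finset.mem_singleton]
    rw [hpf, Finset.card_insert_of_notMem (by simp [hp2.symm, hq2.symm]),
      Finset.card_insert_of_notMem (by simp [hne]), Finset.card_singleton] at h
    rw [hT_def, h]
    norm_num
  -- the ramified primes `𝔭_ℓ = (ℓ, y)`, `ℓ ∈ {2, p, q}`: `𝔭_ℓ² = (ℓ)`
  have h2n : 2 ∣ n := ⟨p * q, rfl⟩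
  have hpn : p ∣ n := ⟨2 * q, by rw [hn_def]; ring⟩
  have hqn : q ∣ n := ⟨2 * p, by rw [hn_def]; ring⟩
  have hP2 := sq_span_pair_eq_span hn hy Nat.prime_two h2n
  have hPp := sq_span_pair_eq_span hn hy hp hpn
  have hPq := sq_span_pair_eq_span hn hy hq hqn
  have hP2₀ := mem_nonZeroDivisors_of_sq_eq_span h2 Nat.prime_two hP2
  have hPp₀ := mem_nonZeroDivisors_of_sq_eq_span h2 hp hPp
  have hPq₀ := mem_nonZeroDivisors_of_sq_eq_span h2 hq hPq
  -- their classes: order dividing `2`, product `1`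
  have hc2sq : ClassGroup.mk0 ⟨_, hP2₀⟩ ^ 2 = 1 := mk0_sq_eq_one_of_sq_eq_span Nat.prime_two hP2 hP2₀
  have hcpsq : ClassGroup.mk0 ⟨_, hPp₀⟩ ^ 2 = 1 := mk0_sq_eq_one_of_sq_eq_span hp hPp hPp₀
  have hcqsq : ClassGroup.mk0 ⟨_, hPq₀⟩ ^ 2 = 1 := mk0_sq_eq_one_of_sq_eq_span hq hPq hPq₀
  have hprod := prod_span_pair_eq_span hn hy h2
  have hnpf : n.primeFactors = {2, p, q} := by
    rw [hn_def, Nat.primeFactors_mul two_ne_zero (Nat.mul_ne_zero hp.ne_zero hq.ne_zero),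
      Nat.primeFactors_mul hp.ne_zero hq.ne_zero, Nat.prime_two.primeFactors, hp.primeFactors,
      hq.primeFactors]
    ext r
    simp only [Finset.mem_union, Finset.mem_insert, Finset.mem_singleton]
  rw [hnpf, Finset.prod_insert (by simp [hp2.symm, hq2.symm]), Finset.prod_insert (by simp [hne]),
    Finset.prod_singleton, ← mul_assoc] at hprod
  have hy0 : (span {y} : Ideal (𝓞 K)) ∈ (Ideal (𝓞 K))⁰ := by
    rw [← hprod]
    exact mul_mem (mul_mem hP2₀ hPp₀) hPq₀
  have hrel : ClassGroup.mk0 ⟨_, hP2₀⟩ * ClassGroup.mk0 ⟨_, hPp₀⟩ * ClassGroup.mk0 ⟨_, hPq₀⟩ = 1 := by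
    have e : (⟨_, hP2₀⟩ * ⟨_, hPp₀⟩ * ⟨_, hPq₀⟩ : (Ideal (𝓞 K))⁰) = ⟨span {y}, hy0⟩ :=
      Subtype.ext hprod
    rw [← map_mul, ← map_mul, e, ClassGroup.mk0_eq_one_iff]
    exact ⟨⟨y, rfl⟩⟩
  -- genus character values: `ε = (p/q) = (q/p)`, `s = (2/q)`
  obtain ⟨ε, hε⟩ : ∃ ε : ℤ, legendreSym q p = ε := ⟨_, rfl⟩
  obtain ⟨s, hs⟩ : ∃ s : ℤ, legendreSym q 2 = s := ⟨_, rfl⟩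
  have hεpq : legendreSym p q = ε := by
    rw [← hε]; exact (legendreSym.quadratic_reciprocity_one_mod_four (by omega) hq2).symm
  have v2p : genusCharValue p (ClassGroup.mk0 ⟨_, hP2₀⟩) = -1 := by
    rw [genusCharValue_mk0_of_sq_eq_span hIQ hp2 hpd Nat.prime_two hp2.symm hP2 hP2₀, Nat.cast_ofNat,
      legendreSym.at_two hp2, ZMod.χ₈_nat_eq_if_mod_eight, if_neg (by omega), if_neg (by omega)]
  have v2q : genusCharValue q (ClassGroup.mk0 ⟨_, hP2₀⟩) = s := by
    rw [genusCharValue_mk0_of_sq_eq_span hIQ hq2 hqd Nat.prime_two hq2.symm hP2 hP2₀, Nat.cast_ofNat, hs]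
  have vqp : genusCharValue p (ClassGroup.mk0 ⟨_, hPq₀⟩) = ε := by
    rw [genusCharValue_mk0_of_sq_eq_span hIQ hp2 hpd hq hne.symm hPq hPq₀, hεpq]
  have vpq : genusCharValue q (ClassGroup.mk0 ⟨_, hPp₀⟩) = ε := by
    rw [genusCharValue_mk0_of_sq_eq_span hIQ hq2 hqd hp hne hPp hPp₀, hε]
  -- via the relation: `[𝔭_q] = [𝔭₂][𝔭_p]`, `[𝔭_p] = [𝔭₂][𝔭_q]`
  have hcq_eq : ClassGroup.mk0 ⟨_, hPq₀⟩ = ClassGroup.mk0 ⟨_, hP2₀⟩ * ClassGroup.mk0 ⟨_, hPp₀⟩ := by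
    calc ClassGroup.mk0 ⟨_, hPq₀⟩
        = ClassGroup.mk0 ⟨_, hP2₀⟩ * ClassGroup.mk0 ⟨_, hPp₀⟩ * ClassGroup.mk0 ⟨_, hPq₀⟩ *
            ClassGroup.mk0 ⟨_, hPq₀⟩ := by rw [hrel, one_mul]
      _ = ClassGroup.mk0 ⟨_, hP2₀⟩ * ClassGroup.mk0 ⟨_, hPp₀⟩ * ClassGroup.mk0 ⟨_, hPq₀⟩ ^ 2 := by
          rw [pow_two, mul_assoc]
      _ = ClassGroup.mk0 ⟨_, hP2₀⟩ * ClassGroup.mk0 ⟨_, hPp₀⟩ := by rw [hcqsq, mul_one]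
  have hcp_eq : ClassGroup.mk0 ⟨_, hPp₀⟩ = ClassGroup.mk0 ⟨_, hP2₀⟩ * ClassGroup.mk0 ⟨_, hPq₀⟩ := by
    have hrel' : ClassGroup.mk0 ⟨_, hP2₀⟩ * ClassGroup.mk0 ⟨_, hPq₀⟩ * ClassGroup.mk0 ⟨_, hPp₀⟩ = 1 := by
      rw [← hrel]; simp only [mul_assoc, mul_comm (ClassGroup.mk0 ⟨_, hPq₀⟩)]
    calc ClassGroup.mk0 ⟨_, hPp₀⟩
        = ClassGroup.mk0 ⟨_, hP2₀⟩ * ClassGroup.mk0 ⟨_, hPq₀⟩ * ClassGroup.mk0 ⟨_, hPp₀⟩ *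
            ClassGroup.mk0 ⟨_, hPp₀⟩ := by rw [hrel', one_mul]
      _ = ClassGroup.mk0 ⟨_, hP2₀⟩ * ClassGroup.mk0 ⟨_, hPq₀⟩ * ClassGroup.mk0 ⟨_, hPp₀⟩ ^ 2 := by
          rw [pow_two, mul_assoc]
      _ = ClassGroup.mk0 ⟨_, hP2₀⟩ * ClassGroup.mk0 ⟨_, hPq₀⟩ := by rw [hcpsq, mul_one]
  have vqq : genusCharValue q (ClassGroup.mk0 ⟨_, hPq₀⟩) = s * ε := by
    rw [hcq_eq, genusCharValue_mul hIQ hq2 hqd, v2q, vpq]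
  have vpp : genusCharValue p (ClassGroup.mk0 ⟨_, hPp₀⟩) = -ε := by
    rw [hcp_eq, genusCharValue_mul hIQ hp2 hpd, v2p, vqp, neg_one_mul]
  have v1p : genusCharValue (K := K) p 1 = 1 := genusCharValue_one hIQ hp2 hpd
  have v1q : genusCharValue (K := K) q 1 = 1 := genusCharValue_one hIQ hq2 hqd
  -- `ε, s ∈ {±1}`, not both `+1`
  have hε1 : ε = 1 ∨ ε = -1 := by
    rw [← vpq]; exact genusCharValue_eq_one_or hIQ _
  have hs1 : s = 1 ∨ s = -1 := by
    rw [← v2q]; exact genusCharValue_eq_one_or hIQ _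
  have hεs : ε = -1 ∨ s = -1 := by
    rcases hpq with hj | hq3
    · left
      rw [← hε, jacobiSym.legendreSym.to_jacobiSym, hj]
    · right
      rw [← hs, legendreSym.at_two hq2, ZMod.χ₈_nat_eq_if_mod_eight, if_neg (by omega), if_neg (by omega)]
  -- the four classes and their character pairs
  set c₂ := ClassGroup.mk0 ⟨_, hP2₀⟩ with hc₂
  set cp := ClassGroup.mk0 ⟨_, hPp₀⟩ with hcp
  set cq := ClassGroup.mk0 ⟨_, hPq₀⟩ with hcq
  set Φ : ClassGroup (𝓞 K) → ℤ × ℤ := fun c => (genusCharValue p c, genusCharValue q c) with hΦ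
  set S : Finset (ClassGroup (𝓞 K)) := {1, c₂, cp, cq} with hS
  have hST : S ⊆ T := by
    intro c hc
    rw [hT_def, Finset.mem_filter]
    refine ⟨Finset.mem_univ _, ?_⟩
    simp only [hS, Finset.mem_insert, Finset.mem_singleton] at hc
    rcases hc with rfl | rfl | rfl | rfl
    · exact one_pow 2
    · exact hc2sq
    · exact hcpsq
    · exact hcqsq
  have himg : S.image Φ = {((1 : ℤ), (1 : ℤ)), (-1, s), (-ε, ε), (ε, s * ε)} := by
    simp only [hS, hΦ, Finset.image_insert, Finset.image_singleton, v1p, v1q, v2p, v2q, vpp, vpq,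
      vqp, vqq]
  have hcard4 : ({((1 : ℤ), (1 : ℤ)), (-1, s), (-ε, ε), (ε, s * ε)} : Finset (ℤ × ℤ)).card = 4 := by
    rcases hε1 with rfl | rfl <;> rcases hs1 with rfl | rfl
    · norm_num at hεs
    · decide
    · decide
    · decide
  have hle1 : (S.image Φ).card ≤ S.card := Finset.card_image_le
  have hle2 : S.card ≤ T.card := Finset.card_le_card hST
  rw [himg, hcard4] at hle1
  have hScard : S.card = 4 := by omega
  have hinj : Set.InjOn Φ ↑S := Finset.card_image_iff.mp (by rw [himg, hcard4, hScard])
  have hSeqT : S = T := Finset.eq_of_subset_of_card_le hST (by rw [hT, hScard])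
  -- conclusion: a square of order dividing `2` is `1`
  rw [Literature.NumberTheory.EllipticCurves.Tian2014.fourTwoCard_def, Nat.card_eq_one_iff_exists]
  refine ⟨⟨1, IsSquare.one, one_pow 2⟩, ?_⟩
  rintro ⟨a, hsqa, ha2⟩
  apply Subtype.ext
  have haT : a ∈ T := by
    rw [hT_def, Finset.mem_filter]
    exact ⟨Finset.mem_univ _, ha2⟩
  rw [← hSeqT] at haT
  have h1S : (1 : ClassGroup (𝓞 K)) ∈ S := by simp [hS]
  have hΦa : Φ a = Φ 1 := by
    simp only [hΦ]
    rw [genusCharValue_eq_one_of_isSquare hIQ hp2 hpd hsqa,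
      genusCharValue_eq_one_of_isSquare hIQ hq2 hqd hsqa, v1p, v1q]
  exact hinj haT h1S hΦa

end Literature.NumberTheory.QuadraticFields.RedeiReichardt

end
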